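/-
Copyright (c) 2026 the pub-hodgecm-mathlib formalisation cell (harness21).  Prover seat hodgecm-mathlib-K2Liu-p14 (g3), Track B «K2-LIT»,
#184♮ = hLiu418 = `stmt-HodgeConjecture-24832`; Road I v3, S5-F3 lineage ∕ I4-conv (F′-fact), E-FINAL: the inner-section family of term 2 IS a factorizable line family.
-/
import Summits.HodgeConjecture.HodgeConjecture.Theorems.K2LiuKlingenInnerSectionEulerIdentity       -- ★ E-3b: `exists_innerSection_euler` (+ ★ E-3a, E-D0, E-2, E-1, C, hK, B, B2)
import Summits.HodgeConjecture.HodgeConjecture.Theorems.K2LiuKlingenInnerSectionLocalLawAssembly   -- ★ (F0P2-p10) §1 `innerSectionLoc_lambdaLoc_upper_mul` = the local Borel law `hlaw`, closed by name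
import Summits.HodgeConjecture.HodgeConjecture.Theorems.K2LiuKlingenTransportPlaceReading          -- ★ (F0P2-p09) PR1–PR4: the place-`w` readings of the F-files' pins
import Summits.HodgeConjecture.HodgeConjecture.Theorems.K2LiuKlingenTransportIntegral              -- ★ (F0P2-p09) PR5: `psiLoc_mem_localInt_of_mem`
import HarnessLib

/-!
# Crux `HLiu418`, I4-conv (F′-fact), E-FINAL — `K2LiuKlingenInnerSectionFactorizableLine`: THE INNER-SECTION FAMILY OF TERM 2 IS A FACTORIZABLE LINE FAMILY
# `∃ g gT′, IsFactorizableOff¹ T′ χ g gT′ ∧ F′_{h,f_s}(g₂) = g (s − ½) (Ψ_S g₂)`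

Cell `hodgecm-mathlib`, crux item hLiu418 = `stmt-HodgeConjecture-24832`; squad K2 ∕ K2Liu; LEAD F0P6-plan (g14) BATCH #36 («=» on the ARCHITECTURE: WRITE the factorizable line family,
PROVE the Euler identity on the convergence region; E = K2Liu-p14 (g3)).  THEOREMS ONLY (no `def`, no instance, no notation, no named-fact hypothesis, no `sorry`);
lane `--supports stmt-HodgeConjecture-24832 --as helper` (count-neutral).

THE ORGAN I4-conv (F′-fact), ASSEMBLED.  For the F-files' transport `Ψ : U(J₄)(𝔸) ≃ₜ* H(𝔸) = U(2,2)(𝔸)` pinned by `(SA, X, Y, a)` (★ carrier (A) §4 binders `hΨ ha hSA hSAi`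
VERBATIM), a family `f` ★ #31s-factorizable off `T′` (`hfac`), `h ∈ H(𝔸)`, the Klingen fibre `Y(𝔸) × 𝔸_L` with Haar measures (`μ_Y ⊗ μ_T`; local Haar measures `ν_{Y,v}`,
`ν_{T,v}` normalised on integral pairs off `T′`), a line bridge `Ψ_S : U(J₂)(𝔸) ≃ₜ* H₁(𝔸)` (BY VALUE, with its three place readings `hbr`, `hbrT`, `hbrA` — for the bridge of
record ★ (A) `adelicUnitaryGroupCongr L S hermD¹ J₂ (bridge_congr_over L S hS)` they are F0P2-p10 (g2)'s `K2LiuKlingenBridgePlaceReading`), and `T′ ⊇` the places above `2`,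
the ramification of `χ`, the non-units of `δ`, the non-integral places of `h` and of `SA`:
**`∃ (g : ℂ → H₁(𝔸) → ℂ) (gT′), IsFactorizableOff L e₁ 1 1 T′ χ g gT′ ∧ ∀ s g₂, Integrable(term-2 integrand at (s, g₂)) → F′_{h,f_s}(g₂) = g (s − ½) (Ψ_S g₂)`**, where
`F′_{h,f_s}(g₂) = ∫_{Y(𝔸)×𝔸_L} f_s(Ψ(ξ)Ψ(n_Q(y,0,t))Ψ(m_Q(1,j₂⁻¹g₂))h) d(μ_Y ⊗ μ_T)` is ★ F8's inner section of term 2 — so the section `x ↦ F′_{h,f_s}(Ψ_S⁻¹ x)` of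
`I_Δ,line(s − ½, χ)` (★ (A) `isSiegelDeltaSection_innerSection_comp_bridgeOver_symm`), whose Siegel Eisenstein series IS term 2 (★ (A)), coincides on the convergence region with
the value at `s − ½` of a family `g` that is ★ #31s `IsFactorizableOff` BY CONSTRUCTION: `g s′ x := gT′ s′ (x_∞, x_{T′}) · ∏ᶠ_{v∉T′} Λ¹_{s′,v}(x_v)`,
`gT′ s′ := Function.extend (x ↦ (x_∞, x_{T′})) (x ↦ A_{s′+½}(Ψ_S⁻¹ x)) 0`, `A_s(g₂) := (∫ gN s g₂ ∘ R dμ) · ∏'_{v∉T′} J_{s,v}(1)` (★ E-3b's Euler identity with ★ C's local Borel law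
DISCHARGED: ★ `innerSectionLoc_lambdaLoc_upper_mul` fed by ★ PR1–PR4 at `Ψ_v := psiLoc Ψ v`; `hΨK` ← ★ PR5).  Road Φ's ★ Φ3d `whittakerDelta_eq_mul_tprod_euler` at `n := 1` then
reads the Fourier coefficients of term 2 as Euler products (I4 proper).
* §1 `factorsThrough_key` — `x ↦ A_{s}(Ψ_S⁻¹ x)` factors through `x ↦ (x_∞, x_{T′})` (★ E-3b's `gN`-dependence clause + `hbrT`, `hbrA`).
* §2 **`exists_factorizable_line`** — THE HEAD (statement above; at `g₂ := Ψ_S⁻¹ x` it reads `F′_{h,f_s}(Ψ_S⁻¹ x) = g (s − ½) x` by `apply_symm_apply`).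
[CasselsFrohlichANT1967, Ch. XV (Tate) §3.3 Thm. 3.3.1], [MoeglinWaldspurger1995, II.1.7], [Liu2011, §2B p. 862, §2C (2-4)], [Tan1999, §1–§2], [Casselman1980, §3].
HONEST LABEL.  Count-neutral helper, closes no socket: `HC_CM` is proved only modulo the 7 printed citations (2 remaining named inputs: hLiu418 =
`stmt-HodgeConjecture-24832`, h413 = `stmt-HodgeConjecture-24833`) until rung 0 closes.
-/

set_option autoImplicit false
set_option linter.dupNamespace false -- the mandated namespace repeats `HodgeConjecture.HodgeConjecture`

noncomputable section

open scoped Matrix ENNReal NNReal Topology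
open NumberField IsDedekindDomain MeasureTheory Measure Filter Set

namespace Summit.HodgeConjecture.HodgeConjecture.Cruxes.HLiu418.K2LiuKlingenInnerSectionFactorizableLine

open Literature.NumberTheory.Automorphic Literature.NumberTheory.Automorphic.UnitaryGroup
open Literature.NumberTheory.GelbartRogawski1991 Literature.NumberTheory.GelbartRogawski1991.GRConstruction
open Literature.NumberTheory.GaloisRepresentations
open Literature.NumberTheory.K2Lit.SiegelDoubled Literature.NumberTheory.K2Lit.LocalSiegelDoubled
open Summit.HodgeConjecture.HodgeConjecture.Cruxes.HLiu418.K2LiuKlingenParabolicDefs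
open Summit.HodgeConjecture.HodgeConjecture.Cruxes.HLiu418.K2LiuKlingenUnipotentAdelicDefs
open Summit.HodgeConjecture.HodgeConjecture.Cruxes.HLiu418.K2LiuSiegelDoubledLeviMatrix (conjAdele_conjAdele')
open Summit.HodgeConjecture.HodgeConjecture.Cruxes.HLiu418.K2LiuKlingenInnerSectionLocalDefs
open Summit.HodgeConjecture.HodgeConjecture.Cruxes.HLiu418.K2LiuKlingenInnerSectionEulerIdentity (exists_innerSection_euler)
open Summit.HodgeConjecture.HodgeConjecture.Cruxes.HLiu418.K2LiuKlingenInnerSectionLocalLawAssembly (innerSectionLoc_lambdaLoc_upper_mul)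
open Summit.HodgeConjecture.HodgeConjecture.Cruxes.HLiu418.K2LiuKlingenTransportPlaceReading
open Summit.HodgeConjecture.HodgeConjecture.Cruxes.HLiu418.K2LiuKlingenTransportIntegral (psiLoc_mem_localInt_of_mem)
open Summit.HodgeConjecture.HodgeConjecture.Cruxes.HLiu418.K2LiuLineBridgeLocalDictionary (formCongr_bridge)

variable (L : Type) [Field L] [NumberField L] [IsCMField L]

/-! ## §1 The `T′`-part factors through the line key `x ↦ (x_∞, x_{T′})` -/

/-- **`x ↦ A(Ψ_S⁻¹ x)` FACTORS THROUGH `x ↦ (x_∞, ((x_v)_{v∈T′}))`** whenever `A(g₂)` depends on `g₂` only through `(archPart g₂, ((g₂)_v)_{v∈T′})` (★ E-3b's clause for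
`gN s`) and the bridge reads places and the archimedean part (`hbrT`, `hbrA`). [cite: BorelJacquet1979, §4.1] [cite: MoeglinWaldspurger1995, II.1.7] -/
theorem factorsThrough_key (T' : Finset (HeightOneSpectrum (𝓞 (Fp L))))
    (ΨS : (quasiSplit (Fp L) L (IsCMField.complexConj L) 2).Adelic ≃ₜ*
      HA L (Equiv.prodUnique (Fin 1) (Fin 1)) (fun _ => (1 : L)) (fun _ => map_one _) (fun _ => (1 : L)) (fun _ => map_one _))
    (hbrT : ∀ (v : HeightOneSpectrum (𝓞 (Fp L)))
      (x x' : HA L (Equiv.prodUnique (Fin 1) (Fin 1)) (fun _ => (1 : L)) (fun _ => map_one _) (fun _ => (1 : L)) (fun _ => map_one _)),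
      evalPlace (Fp L) L (IsCMField.complexConj L) (1 + 1) (hermD L (Equiv.prodUnique (Fin 1) (Fin 1)) (fun _ => (1 : L)) (fun _ => map_one _) (fun _ => (1 : L)) (fun _ => map_one _)) v
          (finPart (Fp L) L (IsCMField.complexConj L) (1 + 1) _ x) =
        evalPlace (Fp L) L (IsCMField.complexConj L) (1 + 1) (hermD L (Equiv.prodUnique (Fin 1) (Fin 1)) (fun _ => (1 : L)) (fun _ => map_one _) (fun _ => (1 : L)) (fun _ => map_one _)) v
          (finPart (Fp L) L (IsCMField.complexConj L) (1 + 1) _ x') →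
      evalPlace (Fp L) L (IsCMField.complexConj L) 2 ((StdForm.antidiagonal 2).over L) v (finPart (Fp L) L (IsCMField.complexConj L) 2 ((StdForm.antidiagonal 2).over L) (ΨS.symm x)) =
        evalPlace (Fp L) L (IsCMField.complexConj L) 2 ((StdForm.antidiagonal 2).over L) v (finPart (Fp L) L (IsCMField.complexConj L) 2 ((StdForm.antidiagonal 2).over L) (ΨS.symm x')))
    (hbrA : ∀ x x' : HA L (Equiv.prodUnique (Fin 1) (Fin 1)) (fun _ => (1 : L)) (fun _ => map_one _) (fun _ => (1 : L)) (fun _ => map_one _),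
      archPart (Fp L) L (IsCMField.complexConj L) (1 + 1) (hermD L (Equiv.prodUnique (Fin 1) (Fin 1)) (fun _ => (1 : L)) (fun _ => map_one _) (fun _ => (1 : L)) (fun _ => map_one _)) x =
        archPart (Fp L) L (IsCMField.complexConj L) (1 + 1) (hermD L (Equiv.prodUnique (Fin 1) (Fin 1)) (fun _ => (1 : L)) (fun _ => map_one _) (fun _ => (1 : L)) (fun _ => map_one _)) x' →
      archPart (Fp L) L (IsCMField.complexConj L) 2 ((StdForm.antidiagonal 2).over L) (ΨS.symm x) =
        archPart (Fp L) L (IsCMField.complexConj L) 2 ((StdForm.antidiagonal 2).over L) (ΨS.symm x'))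
    {A : (quasiSplit (Fp L) L (IsCMField.complexConj L) 2).Adelic → ℂ}
    (hA : ∀ g₂ g₂' : (quasiSplit (Fp L) L (IsCMField.complexConj L) 2).Adelic,
      archPart (Fp L) L (IsCMField.complexConj L) 2 ((StdForm.antidiagonal 2).over L) g₂ = archPart (Fp L) L (IsCMField.complexConj L) 2 ((StdForm.antidiagonal 2).over L) g₂' →
      (∀ v : T', evalPlace (Fp L) L (IsCMField.complexConj L) 2 ((StdForm.antidiagonal 2).over L) v.1 (finPart (Fp L) L (IsCMField.complexConj L) 2 ((StdForm.antidiagonal 2).over L) g₂) =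
        evalPlace (Fp L) L (IsCMField.complexConj L) 2 ((StdForm.antidiagonal 2).over L) v.1 (finPart (Fp L) L (IsCMField.complexConj L) 2 ((StdForm.antidiagonal 2).over L) g₂')) →
      A g₂ = A g₂') :
    Function.FactorsThrough (fun x => A (ΨS.symm x))
      (fun x : HA L (Equiv.prodUnique (Fin 1) (Fin 1)) (fun _ => (1 : L)) (fun _ => map_one _) (fun _ => (1 : L)) (fun _ => map_one _) =>
        (archPart (Fp L) L (IsCMField.complexConj L) (1 + 1) (hermD L (Equiv.prodUnique (Fin 1) (Fin 1)) (fun _ => (1 : L)) (fun _ => map_one _) (fun _ => (1 : L)) (fun _ => map_one _)) x,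
          fun v : T' => evalPlace (Fp L) L (IsCMField.complexConj L) (1 + 1)
            (hermD L (Equiv.prodUnique (Fin 1) (Fin 1)) (fun _ => (1 : L)) (fun _ => map_one _) (fun _ => (1 : L)) (fun _ => map_one _)) v.1
            (finPart (Fp L) L (IsCMField.complexConj L) (1 + 1) _ x))) := by
  intro x x' hxx
  obtain ⟨h1, h2⟩ := Prod.ext_iff.1 hxx
  exact hA _ _ (hbrA x x' h1) fun v => hbrT v.1 x x' (congrFun h2 v)

/-! ## §2 THE HEAD: the inner-section family of term 2 is a factorizable line family -/

section Head

variable {N M : ℕ} {e : Fin N × Fin M ≃ Fin 2}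
  {dV : Fin N → L} {hdV : ∀ i, IsCMField.complexConj L (dV i) = dV i}
  {dW : Fin M → L} {hdW : ∀ i, IsCMField.complexConj L (dW i) = dW i}

set_option simprocs false in -- `dsimp only` below must be pure β∕η: the `Nat` simprocs would rewrite the numerals `2 + 2`, `1 + 1` of the currencies
set_option maxHeartbeats 800000 in -- MEASURED (fails 400000; as ★ E-3b): the statement alone crosses the (2+2)∕4 and (1+1)∕2 currencies at `whnf`
/-- **THE INNER-SECTION FAMILY OF TERM 2 IS A FACTORIZABLE LINE FAMILY** (statement and construction in the header).  Binders: measurable structures and the Klingen-fibre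
measures (as ★ E-D0∕E-3b, local measures `ν_{Y,v}`, `ν_{T,v}` additive Haar and σ-finite, normalised off `T′` by `hν1`); the F-files' transport pins `hΨ ha hSA hSAi` (★ carrier (A)
§4 VERBATIM) with `SA` integral off `T′` (`hSint`, ★ PR5's cofinite letter puts its bad places into `T′`); `χ` unramified off `T′`; `|2| = 1` off `T′` in both spellings (`h2`,
`h2w`); `δ` a unit off `T′`; `f` ★ #31s-factorizable off `T′`; `h` integral off `T′`; the line bridge `Ψ_S` BY VALUE with its bridge matrix `S` (`hS`, `hS'`) and place readings
`hbr` (`(Ψ_S g₂)_v = Ψ_{S,v}((g₂)_v)`, `Ψ_{S,v} = ★ localCongr … S … v`), `hbrT`, `hbrA`.  Per `(s, g₂)` only the integrability of the term-2 integrand is asked.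
[cite: CasselsFrohlichANT1967, Ch. XV (Tate) §3.3 Thm. 3.3.1] [cite: MoeglinWaldspurger1995, II.1.7] [cite: Liu2011, §2B p. 862] [cite: Tan1999, §1] -/
theorem exists_factorizable_line
    [MeasurableSpace (AdeleRing (𝓞 L) L)] [BorelSpace (AdeleRing (𝓞 L) L)]
    [MeasurableSpace (InfiniteAdeleRing (Fp L))] [BorelSpace (InfiniteAdeleRing (Fp L))]
    [∀ v : HeightOneSpectrum (𝓞 (Fp L)), MeasurableSpace (v.adicCompletion (Fp L))] [∀ v : HeightOneSpectrum (𝓞 (Fp L)), BorelSpace (v.adicCompletion (Fp L))]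
    [∀ v : HeightOneSpectrum (𝓞 (Fp L)), MeasurableSpace (LocalRing L v)] [∀ v : HeightOneSpectrum (𝓞 (Fp L)), BorelSpace (LocalRing L v)]
    {δ : L} (hσδ : IsCMField.complexConj L δ = -δ) (hδ : δ ≠ 0)
    (Y : AddSubgroup (AdeleRing (𝓞 L) L)) (hY : ∀ y, y ∈ Y ↔ conjAdele (Fp L) L (IsCMField.complexConj L) y = -y)
    (μY : Measure ↥Y) (μT : Measure (AdeleRing (𝓞 L) L)) [μY.IsAddHaarMeasure] [μT.IsAddHaarMeasure]
    (T' : Finset (HeightOneSpectrum (𝓞 (Fp L))))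
    (νY : ∀ v : HeightOneSpectrum (𝓞 (Fp L)), Measure ↥(skewLoc L v)) (νT : ∀ v : HeightOneSpectrum (𝓞 (Fp L)), Measure (LocalRing L v))
    [∀ v, SFinite (νY v)] [∀ v, (νY v).IsAddLeftInvariant] [∀ v, SFinite (νT v)] [∀ v, (νT v).IsAddHaarMeasure]
    [∀ v, ((νY v).prod (νT v)).IsAddHaarMeasure]
    (h2 : ∀ v, v ∉ T' → Valued.v ((2 : Fp L) : v.adicCompletion (Fp L)) = 1)
    (h2w : ∀ v, v ∉ T' → ∀ w : PlacesOver L v, ValuativeRel.valuation (w.1.adicCompletion L) (2 : w.1.adicCompletion L) = 1)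
    (hδv : ∀ v, v ∉ T' → ∀ w : PlacesOver L v, Valued.v (algebraMap L (w.1.adicCompletion L) δ) = 1)
    (hν1 : ∀ v, v ∉ T' → ((νY v).prod (νT v))
      {q : ↥(skewLoc L v) × LocalRing L v | (∀ w : PlacesOver L v, (q.1 : LocalRing L v) w ∈ w.1.adicCompletionIntegers L) ∧
        ∀ w : PlacesOver L v, q.2 w ∈ w.1.adicCompletionIntegers L} = 1)
    -- the F-files' transport, pinned (★ carrier (A) `K2LiuKlingenTermTwoTransport` §4 binders verbatim)
    {SA : GL (Fin (2 + 2)) (AdeleRing (𝓞 L) L)} (Ψ : (quasiSplit (Fp L) L (IsCMField.complexConj L) (2 + 2)).Adelic ≃ₜ* HA L e dV hdV dW hdW)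
    {X Y' : Matrix (Fin 2) (Fin 2) (Fp L)} {a : Fp L}
    (hΨ : ∀ g : (quasiSplit (Fp L) L (IsCMField.complexConj L) (2 + 2)).Adelic,
      (((Ψ g : HA L e dV hdV dW hdW) : GL (Fin (2 + 2)) (AdeleRing (𝓞 L) L)) : Matrix (Fin (2 + 2)) (Fin (2 + 2)) (AdeleRing (𝓞 L) L)) =
        (SA : Matrix (Fin (2 + 2)) (Fin (2 + 2)) (AdeleRing (𝓞 L) L)) *
          ((adelicVal (Fp L) L (IsCMField.complexConj L) (2 + 2) _ g : GL (Fin (2 + 2)) (AdeleRing (𝓞 L) L)) :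
            Matrix (Fin (2 + 2)) (Fin (2 + 2)) (AdeleRing (𝓞 L) L)) *
          ((SA⁻¹ : GL (Fin (2 + 2)) (AdeleRing (𝓞 L) L)) : Matrix (Fin (2 + 2)) (Fin (2 + 2)) (AdeleRing (𝓞 L) L)))
    (ha : a + a = 1)
    (hSA : Matrix.reindex (e₂ (n := 2)).symm (e₂ (n := 2)).symm (SA : Matrix (Fin (2 + 2)) (Fin (2 + 2)) (AdeleRing (𝓞 L) L)) =
      Matrix.fromBlocks (1 : Matrix (Fin 2) (Fin 2) (AdeleRing (𝓞 L) L)) (X.map ((algebraMap L (AdeleRing (𝓞 L) L)).comp (algebraMap (Fp L) L))) 1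
        (-(X.map ((algebraMap L (AdeleRing (𝓞 L) L)).comp (algebraMap (Fp L) L)))))
    (hSAi : Matrix.reindex (e₂ (n := 2)).symm (e₂ (n := 2)).symm ((SA⁻¹ : GL (Fin (2 + 2)) (AdeleRing (𝓞 L) L)) : Matrix (Fin (2 + 2)) (Fin (2 + 2)) (AdeleRing (𝓞 L) L)) =
      Matrix.fromBlocks ((a • (1 : Matrix (Fin 2) (Fin 2) (Fp L))).map ((algebraMap L (AdeleRing (𝓞 L) L)).comp (algebraMap (Fp L) L)))
        ((a • (1 : Matrix (Fin 2) (Fin 2) (Fp L))).map ((algebraMap L (AdeleRing (𝓞 L) L)).comp (algebraMap (Fp L) L)))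
        (Y'.map ((algebraMap L (AdeleRing (𝓞 L) L)).comp (algebraMap (Fp L) L)))
        (-(Y'.map ((algebraMap L (AdeleRing (𝓞 L) L)).comp (algebraMap (Fp L) L)))))
    (hSint : ∀ v, v ∉ T' → ∀ w : PlacesOver L v, GLn.evalAt (2 + 2) L w.1 (GLn.sndHom (2 + 2) L SA) ∈ glInt (2 + 2) (w.1.adicCompletion L))
    (χ : HeckeCharacter L) (hχ : ∀ v, v ∉ T' → ∀ w : PlacesOver L v, χ.IsUnramifiedAt w.1)
    (f : ℂ → HA L e dV hdV dW hdW → ℂ)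
    (fT : ℂ → arch (Fp L) L (IsCMField.complexConj L) (2 + 2) (hermD L e dV hdV dW hdW) ×
      (Π v : T', localPi L (IsCMField.complexConj L) (2 + 2) (hermD L e dV hdV dW hdW) v.1) → ℂ)
    (hfac : IsFactorizableOff L e dV hdV dW hdW T' χ f fT) (h : HA L e dV hdV dW hdW)
    (hh : ∀ v, v ∉ T' → evalPlace (Fp L) L (IsCMField.complexConj L) (2 + 2) (hermD L e dV hdV dW hdW) v
      (finPart (Fp L) L (IsCMField.complexConj L) (2 + 2) (hermD L e dV hdV dW hdW) h) ∈ localInt L (IsCMField.complexConj L) (2 + 2) (hermD L e dV hdV dW hdW) v)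
    -- the line bridge `Ψ_S` (BY VALUE) with its matrix `S` and its three place readings
    (S : GL (Fin 2) L) (hS : (S : Matrix (Fin 2) (Fin 2) L) = !![1, 2⁻¹; 1, -2⁻¹]) (hS' : ((S⁻¹ : GL (Fin 2) L) : Matrix (Fin 2) (Fin 2) L) = !![2⁻¹, 2⁻¹; 1, -1])
    (ΨS : (quasiSplit (Fp L) L (IsCMField.complexConj L) 2).Adelic ≃ₜ*
      HA L (Equiv.prodUnique (Fin 1) (Fin 1)) (fun _ => (1 : L)) (fun _ => map_one _) (fun _ => (1 : L)) (fun _ => map_one _))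
    (hbr : ∀ (v : HeightOneSpectrum (𝓞 (Fp L))) (g₂ : (quasiSplit (Fp L) L (IsCMField.complexConj L) 2).Adelic), v ∉ T' →
      evalPlace (Fp L) L (IsCMField.complexConj L) (1 + 1) (hermD L (Equiv.prodUnique (Fin 1) (Fin 1)) (fun _ => (1 : L)) (fun _ => map_one _) (fun _ => (1 : L)) (fun _ => map_one _)) v
          (finPart (Fp L) L (IsCMField.complexConj L) (1 + 1) _ (ΨS g₂)) =
        ((localCongr L (IsCMField.complexConj L) S one_ne_zero ((formCongr_bridge L S hS).trans (antidiagOne_eq_over L 2)) v :)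
          (evalPlace (Fp L) L (IsCMField.complexConj L) 2 ((StdForm.antidiagonal 2).over L) v
            (finPart (Fp L) L (IsCMField.complexConj L) 2 ((StdForm.antidiagonal 2).over L) g₂)) :
          localPi L (IsCMField.complexConj L) (1 + 1) (hermD L (Equiv.prodUnique (Fin 1) (Fin 1)) (fun _ => (1 : L)) (fun _ => map_one _) (fun _ => (1 : L)) (fun _ => map_one _)) v))
    (hbrT : ∀ (v : HeightOneSpectrum (𝓞 (Fp L)))
      (x x' : HA L (Equiv.prodUnique (Fin 1) (Fin 1)) (fun _ => (1 : L)) (fun _ => map_one _) (fun _ => (1 : L)) (fun _ => map_one _)),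
      evalPlace (Fp L) L (IsCMField.complexConj L) (1 + 1) (hermD L (Equiv.prodUnique (Fin 1) (Fin 1)) (fun _ => (1 : L)) (fun _ => map_one _) (fun _ => (1 : L)) (fun _ => map_one _)) v
          (finPart (Fp L) L (IsCMField.complexConj L) (1 + 1) _ x) =
        evalPlace (Fp L) L (IsCMField.complexConj L) (1 + 1) (hermD L (Equiv.prodUnique (Fin 1) (Fin 1)) (fun _ => (1 : L)) (fun _ => map_one _) (fun _ => (1 : L)) (fun _ => map_one _)) v
          (finPart (Fp L) L (IsCMField.complexConj L) (1 + 1) _ x') →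
      evalPlace (Fp L) L (IsCMField.complexConj L) 2 ((StdForm.antidiagonal 2).over L) v (finPart (Fp L) L (IsCMField.complexConj L) 2 ((StdForm.antidiagonal 2).over L) (ΨS.symm x)) =
        evalPlace (Fp L) L (IsCMField.complexConj L) 2 ((StdForm.antidiagonal 2).over L) v (finPart (Fp L) L (IsCMField.complexConj L) 2 ((StdForm.antidiagonal 2).over L) (ΨS.symm x')))
    (hbrA : ∀ x x' : HA L (Equiv.prodUnique (Fin 1) (Fin 1)) (fun _ => (1 : L)) (fun _ => map_one _) (fun _ => (1 : L)) (fun _ => map_one _),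
      archPart (Fp L) L (IsCMField.complexConj L) (1 + 1) (hermD L (Equiv.prodUnique (Fin 1) (Fin 1)) (fun _ => (1 : L)) (fun _ => map_one _) (fun _ => (1 : L)) (fun _ => map_one _)) x =
        archPart (Fp L) L (IsCMField.complexConj L) (1 + 1) (hermD L (Equiv.prodUnique (Fin 1) (Fin 1)) (fun _ => (1 : L)) (fun _ => map_one _) (fun _ => (1 : L)) (fun _ => map_one _)) x' →
      archPart (Fp L) L (IsCMField.complexConj L) 2 ((StdForm.antidiagonal 2).over L) (ΨS.symm x) =
        archPart (Fp L) L (IsCMField.complexConj L) 2 ((StdForm.antidiagonal 2).over L) (ΨS.symm x')) :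
    haveI : Algebra.IsQuadraticExtension (Fp L) L := IsCMField.isQuadraticExtension L
    ∃ (g : ℂ → HA L (Equiv.prodUnique (Fin 1) (Fin 1)) (fun _ => (1 : L)) (fun _ => map_one _) (fun _ => (1 : L)) (fun _ => map_one _) → ℂ)
      (gT' : ℂ → arch (Fp L) L (IsCMField.complexConj L) (1 + 1)
          (hermD L (Equiv.prodUnique (Fin 1) (Fin 1)) (fun _ => (1 : L)) (fun _ => map_one _) (fun _ => (1 : L)) (fun _ => map_one _)) ×
        (Π v : T', localPi L (IsCMField.complexConj L) (1 + 1)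
          (hermD L (Equiv.prodUnique (Fin 1) (Fin 1)) (fun _ => (1 : L)) (fun _ => map_one _) (fun _ => (1 : L)) (fun _ => map_one _)) v.1) → ℂ),
      IsFactorizableOff L (Equiv.prodUnique (Fin 1) (Fin 1)) (fun _ => (1 : L)) (fun _ => map_one _) (fun _ => (1 : L)) (fun _ => map_one _) T' χ g gT' ∧
      ∀ (s : ℂ) (g₂ : (quasiSplit (Fp L) L (IsCMField.complexConj L) 2).Adelic),
        Integrable (fun q : ↥Y × AdeleRing (𝓞 L) L =>
          f s (Ψ (jAdelic L 4 (weylXi (AdeleRing (𝓞 L) L) (conjAdele (Fp L) L (IsCMField.complexConj L)))) *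
            Ψ (jAdelic L 4 (nKlingen (AdeleRing (𝓞 L) L) (conjAdele (Fp L) L (IsCMField.complexConj L)) (conjAdele_conjAdele' L)
              (((q.1 : ↥Y) : AdeleRing (𝓞 L) L)) ((hY _).1 q.1.2) 0 q.2)) *
            (Ψ (jAdelic L 4 (klingenLevi (AdeleRing (𝓞 L) L) (conjAdele (Fp L) L (IsCMField.complexConj L)) (conjAdele_conjAdele' L) 1 ((jAdelic L 2).symm g₂))) * h))) (μY.prod μT) →
        ∫ q : ↥Y × AdeleRing (𝓞 L) L,
            f s (Ψ (jAdelic L 4 (weylXi (AdeleRing (𝓞 L) L) (conjAdele (Fp L) L (IsCMField.complexConj L)))) *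
              Ψ (jAdelic L 4 (nKlingen (AdeleRing (𝓞 L) L) (conjAdele (Fp L) L (IsCMField.complexConj L)) (conjAdele_conjAdele' L)
                (((q.1 : ↥Y) : AdeleRing (𝓞 L) L)) ((hY _).1 q.1.2) 0 q.2)) *
              (Ψ (jAdelic L 4 (klingenLevi (AdeleRing (𝓞 L) L) (conjAdele (Fp L) L (IsCMField.complexConj L)) (conjAdele_conjAdele' L) 1 ((jAdelic L 2).symm g₂))) * h)) ∂(μY.prod μT) =
          g (s - 1 / 2) (ΨS g₂) := by
  classical
  haveI : Algebra.IsQuadraticExtension (Fp L) L := IsCMField.isQuadraticExtension L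
  -- ★ E-3b with `Ψ` read as a homomorphism pinned by `SA` (★ B's currency) and `hΨK` ← ★ PR5
  obtain ⟨μ, gN, hμH, hσf, hgN2, hE⟩ := exists_innerSection_euler L hσδ hδ Y hY μY μT T' νY νT h2 h2w hδv hν1 Ψ.toMulEquiv.toMonoidHom SA (fun g => hΨ g)
    (fun v hv k hk => psiLoc_mem_localInt_of_mem L v Ψ.toMulEquiv.toMonoidHom SA (fun g => hΨ g) (hSint v hv) hk) χ hχ f fT hfac h hh S hS hS'
  haveI := hμH
  -- the `T′`-value `A_s(g₂) := (∫ gN s g₂ ∘ R dμ) · ∏'_{v∉T′} J_{s,v}(1)` and the line family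
  refine ⟨fun s' x => Function.extend
        (fun x : HA L (Equiv.prodUnique (Fin 1) (Fin 1)) (fun _ => (1 : L)) (fun _ => map_one _) (fun _ => (1 : L)) (fun _ => map_one _) =>
          (archPart (Fp L) L (IsCMField.complexConj L) (1 + 1) (hermD L (Equiv.prodUnique (Fin 1) (Fin 1)) (fun _ => (1 : L)) (fun _ => map_one _) (fun _ => (1 : L)) (fun _ => map_one _)) x,
            fun v : T' => evalPlace (Fp L) L (IsCMField.complexConj L) (1 + 1)
              (hermD L (Equiv.prodUnique (Fin 1) (Fin 1)) (fun _ => (1 : L)) (fun _ => map_one _) (fun _ => (1 : L)) (fun _ => map_one _)) v.1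
              (finPart (Fp L) L (IsCMField.complexConj L) (1 + 1) _ x)))
        (fun x => (∫ z, gN (s' + 1 / 2) (ΨS.symm x)
            ((quadraticInfiniteAdeleEquiv (Fp L) L (not_mem_range_algebraMap_of_apply_eq_neg L (IsCMField.complexConj L) hσδ hδ) (0, z.1 0),
              quadraticInfiniteAdeleEquiv (Fp L) L (not_mem_range_algebraMap_of_apply_eq_neg L (IsCMField.complexConj L) hσδ hδ) (z.1 1, z.1 2)), z.2) ∂μ) *
          ∏' v : {v : HeightOneSpectrum (𝓞 (Fp L)) // v ∉ T'},
            innerSectionLoc L v.1 (νY v.1) (νT v.1) (psiLoc L Ψ.toMulEquiv.toMonoidHom v.1) (LambdaLoc L e dV hdV dW hdW v.1 χ (s' + 1 / 2))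
              (evalPlace (Fp L) L (IsCMField.complexConj L) (2 + 2) (hermD L e dV hdV dW hdW) v.1 (finPart (Fp L) L (IsCMField.complexConj L) (2 + 2) (hermD L e dV hdV dW hdW) h)) 1) 0
        (archPart (Fp L) L (IsCMField.complexConj L) (1 + 1) (hermD L (Equiv.prodUnique (Fin 1) (Fin 1)) (fun _ => (1 : L)) (fun _ => map_one _) (fun _ => (1 : L)) (fun _ => map_one _)) x,
          fun v : T' => evalPlace (Fp L) L (IsCMField.complexConj L) (1 + 1)
            (hermD L (Equiv.prodUnique (Fin 1) (Fin 1)) (fun _ => (1 : L)) (fun _ => map_one _) (fun _ => (1 : L)) (fun _ => map_one _)) v.1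
            (finPart (Fp L) L (IsCMField.complexConj L) (1 + 1) _ x)) *
      ∏ᶠ v : {v : HeightOneSpectrum (𝓞 (Fp L)) // v ∉ T'},
        LambdaLoc L (Equiv.prodUnique (Fin 1) (Fin 1)) (fun _ => (1 : L)) (fun _ => map_one _) (fun _ => (1 : L)) (fun _ => map_one _) v.1 χ s'
          (evalPlace (Fp L) L (IsCMField.complexConj L) (1 + 1) _ v.1 (finPart (Fp L) L (IsCMField.complexConj L) (1 + 1) _ x)),
    fun s' p => Function.extend
        (fun x : HA L (Equiv.prodUnique (Fin 1) (Fin 1)) (fun _ => (1 : L)) (fun _ => map_one _) (fun _ => (1 : L)) (fun _ => map_one _) =>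
          (archPart (Fp L) L (IsCMField.complexConj L) (1 + 1) (hermD L (Equiv.prodUnique (Fin 1) (Fin 1)) (fun _ => (1 : L)) (fun _ => map_one _) (fun _ => (1 : L)) (fun _ => map_one _)) x,
            fun v : T' => evalPlace (Fp L) L (IsCMField.complexConj L) (1 + 1)
              (hermD L (Equiv.prodUnique (Fin 1) (Fin 1)) (fun _ => (1 : L)) (fun _ => map_one _) (fun _ => (1 : L)) (fun _ => map_one _)) v.1
              (finPart (Fp L) L (IsCMField.complexConj L) (1 + 1) _ x)))
        (fun x => (∫ z, gN (s' + 1 / 2) (ΨS.symm x)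
            ((quadraticInfiniteAdeleEquiv (Fp L) L (not_mem_range_algebraMap_of_apply_eq_neg L (IsCMField.complexConj L) hσδ hδ) (0, z.1 0),
              quadraticInfiniteAdeleEquiv (Fp L) L (not_mem_range_algebraMap_of_apply_eq_neg L (IsCMField.complexConj L) hσδ hδ) (z.1 1, z.1 2)), z.2) ∂μ) *
          ∏' v : {v : HeightOneSpectrum (𝓞 (Fp L)) // v ∉ T'},
            innerSectionLoc L v.1 (νY v.1) (νT v.1) (psiLoc L Ψ.toMulEquiv.toMonoidHom v.1) (LambdaLoc L e dV hdV dW hdW v.1 χ (s' + 1 / 2))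
              (evalPlace (Fp L) L (IsCMField.complexConj L) (2 + 2) (hermD L e dV hdV dW hdW) v.1 (finPart (Fp L) L (IsCMField.complexConj L) (2 + 2) (hermD L e dV hdV dW hdW) h)) 1) 0 p,
    fun s' x => rfl, fun s g₂ hFi => ?_⟩
  -- the local Borel law of the `J_{s,v}` at every `v ∉ T′` (★ `innerSectionLoc_lambdaLoc_upper_mul` at the frame readings ★ PR1–PR4)
  have key := hE s g₂ hFi (fun v hv b g u hb hu =>
    innerSectionLoc_lambdaLoc_upper_mul L e dV hdV dW hdW v (psiLoc L Ψ.toMulEquiv.toMonoidHom v)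
      (fun w => GLn.evalAt (2 + 2) L w.1 (GLn.sndHom (2 + 2) L SA))
      (fun w => X.map ((algebraMap L (w.1.adicCompletion L)).comp (algebraMap (Fp L) L)))
      (fun w => Y'.map ((algebraMap L (w.1.adicCompletion L)).comp (algebraMap (Fp L) L)))
      (fun w => ((algebraMap L (w.1.adicCompletion L)).comp (algebraMap (Fp L) L)) a)
      (fun w => algebraMap_add_self_eq_one L ha w.1)
      (fun w => reindex_evalAt_sndHom_eq_fromBlocks L SA X hSA w.1)
      (fun w => reindex_evalAt_sndHom_inv_eq_fromBlocks L SA Y' a hSAi w.1)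
      (fun z w => coe_psiLoc_apply_eq_conj L v Ψ.toMulEquiv.toMonoidHom SA (fun g => hΨ g) z w)
      (νY v) (νT v) χ s (hχ v hv) _ b g u hb hu)
  -- `Ψ` as a map vs `Ψ.toMulEquiv.toMonoidHom` (★ E-3b's currency): the two integrands agree definitionally
  refine Eq.trans ?_ (key.trans ?_)
  · rfl
  -- the `T′`-value at `x = Ψ_S g₂`: `Function.extend` along the key (§1) and `(s − ½) + ½ = s`
  have hFT := factorsThrough_key L T' ΨS hbrT hbrA (A := fun g₂' => (∫ z, gN (s - 1 / 2 + 1 / 2) g₂'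
      ((quadraticInfiniteAdeleEquiv (Fp L) L (not_mem_range_algebraMap_of_apply_eq_neg L (IsCMField.complexConj L) hσδ hδ) (0, z.1 0),
        quadraticInfiniteAdeleEquiv (Fp L) L (not_mem_range_algebraMap_of_apply_eq_neg L (IsCMField.complexConj L) hσδ hδ) (z.1 1, z.1 2)), z.2) ∂μ) *
      ∏' v : {v : HeightOneSpectrum (𝓞 (Fp L)) // v ∉ T'},
        innerSectionLoc L v.1 (νY v.1) (νT v.1) (psiLoc L Ψ.toMulEquiv.toMonoidHom v.1) (LambdaLoc L e dV hdV dW hdW v.1 χ (s - 1 / 2 + 1 / 2))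
          (evalPlace (Fp L) L (IsCMField.complexConj L) (2 + 2) (hermD L e dV hdV dW hdW) v.1 (finPart (Fp L) L (IsCMField.complexConj L) (2 + 2) (hermD L e dV hdV dW hdW) h)) 1)
    (fun g₂' g₂'' ha' hT' => by rw [hgN2 (s - 1 / 2 + 1 / 2) g₂' g₂'' ha' hT'])
  have hext := hFT.extend_apply 0 (ΨS g₂)
  dsimp only at hext ⊢
  rw [hext, ContinuousMulEquiv.symm_apply_apply, sub_add_cancel]
  -- the line factors: `(Ψ_S g₂)_v = Ψ_{S,v}((g₂)_v)` (`hbr`)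
  congr 1
  refine finprod_congr fun v => ?_
  rw [hbr v.1 g₂ v.2]

end Head

end Summit.HodgeConjecture.HodgeConjecture.Cruxes.HLiu418.K2LiuKlingenInnerSectionFactorizableLine

end
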